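import Summits.QuantumFields.YangMills.Theorems.LangevinControlUVFemtoCurvatureTwoPointStubPlaquetteProductRPCS
import HarnessLib

/-!
# Route `LangevinControlUV`, crux `FemtoCurvatureTwoPointC` (stmt-QuantumFields-16204): a PARTIAL
# chessboard estimate for the `01`-plaquette field on ODD tori — helpers (file 1 of 2)

On an odd torus `(ℤ/L)⁴`, `L = 2m+1 ≥ 3`, the full chessboard estimate
`E f(P_0) ≤ (E ∏_x f(P_x))^{1/L⁴}` is FALSE for general compact `G`
(`FemtoCurvatureTwoPoint.Negative.ChessboardOddTorus`, `ℤ₂` parity obstruction), and the even-torus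
machinery (`stub_chessboardEven_of_RPCS`, p114602) does not apply: every reflection of an odd cycle
fixes one vertex and one edge. This file proves the volume-uniform SUBSTITUTE that suffices for
exponential / second plaquette moments:

  `(E g(P_0))^{n⁴} ≤ E ∏_{x ∈ B} g(P_x)`  for a box `B` of `n⁴` sites with `L < 2n`,

for every bounded measurable `g ≥ 0` of the `01`-plaquette field `P_x = N − Re tr ρ(U_{x;01})`,
every compact group `G`, continuous `ρ`, `β ≥ 0`, odd `L ≥ 3` (`odd_partialChessboard`, in the
sequel file `…COddPartialChessboard`; this file: the abstract doubling step `sq_integral_prod_le`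
and its iteration, the run bookkeeping on `ℤ/L`, boxes, the transported odd reflection positivity
`integral_oddTheta_mul_nonneg` for GENERAL odd `L`, and the plaquette bookkeeping under the
transported link reflection in the in-plane / transverse directions).

Proof. Osterwalder–Seiler reflection positivity of Wilson's measure on the odd torus for the MIXED
reflection `t ↦ 1 − t` (one link hyperplane, one site hyperplane; tree
`wilsonExpectation_oddReflectionPositive`, real form `AxisCovNonneg.integral_timeReflect_mul_nonneg_odd`)
is transported to every axis and hyperplane by `Φ = τ_v ∘ π_*` (as in the even RPCS file), and the
reflection Cauchy–Schwarz inequality with the constant observable `1` on one side gives the DOUBLING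
step `ψ(S)² ≤ ψ(S ∪ θS)` for `ψ(S) = E ∏_{x∈S} g(P_x)` whenever `S` lies in the admissible half and
is disjoint from its mirror image `θS`. Runs are doubled `1 → 2 → ⋯ → 2^J` in each direction
(`2^{J-1} ≤ m < 2^J`): in the two directions transverse to the plaquette the run sits next to the
link hyperplane and is mirrored across it (slices `{−(q−1),…,0} ↦ {−(2q−1),…,−q}`); in the two
in-plane directions the run of plaquette columns sits next to the fixed site hyperplane and is
mirrored across it (`{0,…,q−1} ↦ {q,…,2q−1}`, orientation reversal being invisible to `Re tr`). The
homogeneous configuration is never reached (it cannot be: parity), but `n = 2^J > L/2` cells per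
direction are, and `g ≥ 1`-type monotonicity is not needed downstream because the consumer bounds
`∏_{x∈B} P_x² ≤ (4/(eβ))^{2|B|} e^{βS/2}` pointwise for every `B`.

References: Fröhlich–Israel–Lieb–Simon, CMP 62 (1978) Thm. 2.1–2.2 (chessboard from RP);
Osterwalder–Seiler, Ann. Phys. 110 (1978) §2; Seiler LNP 159 Ch. 2 (odd periods need the mixed
reflection). All statements here are proved. [folklore]
-/

noncomputable section

open scoped BigOperators
open MeasureTheory
open Literature.MathematicalPhysics.QuantumFieldTheory
open Literature.Barriers.CriticalPhenomena.NonGibbs (cellReflect cellReflect_apply)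

namespace Summit.QuantumFields.YangMills.Theorems.FemtoCurvatureTwoPointC.OddChessboard

open Summit.QuantumFields.YangMills.Theorems.FemtoCurvatureTwoPoint.PlaquetteProductRPCS
open Summit.QuantumFields.YangMills.Theorems.FemtoCurvatureTwoPoint (AxisCovNonneg.integral_timeReflect_mul_nonneg_odd)
open Summit.QuantumFields.YangMills.Theorems.FiniteSusceptibilityWeakCoupling (RPCauchySchwarz.sq_integral_le
  RPCauchySchwarz.theta_theta RPCauchySchwarz.measurable_theta RPCauchySchwarz.map_theta
  RPCauchySchwarz.dependsOn_add_mul RPCauchySchwarz.torusConfigShift_neg_shift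
  RPCauchySchwarz.configPerm_symm_configPerm)

/-! ## Abstract layer: the doubling step and its iteration -/

section Abstract

variable {Ω ι : Type*} [MeasurableSpace Ω] {μ : Measure Ω} {Θ : Ω → Ω} [DecidableEq ι]

/-- **Doubling step** (reflection Cauchy–Schwarz against the constant `1`): for a measurable
measure-preserving involution `Θ` of a probability space, reflection positive on a cone `D ∋ 1`, an
injective index map `θ` with `g(Θω, x) = g(ω, θx)`, and a finite `S` with `∏_S g ∈ D` disjoint from
`θS`: `(∫ ∏_{x∈S} g)² ≤ ∫ ∏_{x ∈ S ∪ θS} g`. [folklore] -/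
theorem sq_integral_prod_le [IsProbabilityMeasure μ] (hΘm : Measurable Θ) (hΘμ : μ.map Θ = μ)
    (hΘΘ : ∀ ω, Θ (Θ ω) = ω) {D : (Ω → ℝ) → Prop}
    (hRP : ∀ H : Ω → ℝ, Measurable H → (∃ C : ℝ, ∀ ω, |H ω| ≤ C) → D H →
      0 ≤ ∫ ω, H (Θ ω) * H ω ∂μ)
    (hD : ∀ (H K : Ω → ℝ) (t : ℝ), D H → D K → D fun ω => H ω + t * K ω) (hD1 : D fun _ => 1)
    {θ : ι → ι} (hθ : Function.Injective θ) (g : Ω → ι → ℝ) (hgm : ∀ x, Measurable fun ω => g ω x)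
    {C : ℝ} (hgb : ∀ ω x, |g ω x| ≤ C) (hgΘ : ∀ ω x, g (Θ ω) x = g ω (θ x)) (S : Finset ι)
    (hSD : D fun ω => ∏ x ∈ S, g ω x) (hdisj : Disjoint S (S.image θ)) :
    (∫ ω, ∏ x ∈ S, g ω x ∂μ) ^ 2 ≤ ∫ ω, ∏ x ∈ (S ∪ S.image θ), g ω x ∂μ := by
  have hAm : Measurable fun ω => ∏ x ∈ S, g ω x :=
    Finset.measurable_prod (f := fun x ω => g ω x) S fun x _ => hgm x
  have hAb : ∃ C' : ℝ, ∀ ω, |∏ x ∈ S, g ω x| ≤ C' :=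
    ⟨C ^ S.card, fun ω => abs_prod_le_pow fun x => hgb ω x⟩
  have key := RPCauchySchwarz.sq_integral_le hΘm hΘμ hΘΘ hRP hD (H := fun _ => (1 : ℝ)) measurable_const
    hAm ⟨1, fun _ => by simp⟩ hAb hD1 hSD
  have hcomp : ∀ ω, ∏ x ∈ S, g (Θ ω) x = ∏ x ∈ S.image θ, g ω x := fun ω => by
    rw [Finset.prod_image fun x _ y _ h => hθ h]
    exact Finset.prod_congr rfl fun x _ => hgΘ ω x
  have hprod : ∀ ω, (∏ x ∈ S, g (Θ ω) x) * ∏ x ∈ S, g ω x = ∏ x ∈ (S ∪ S.image θ), g ω x :=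
    fun ω => by rw [hcomp, mul_comm, Finset.prod_union hdisj]
  simpa only [one_mul, integral_const, probReal_univ, one_smul, hprod] using key

/-- **Iterating squarings**: `a₀^{2^J} ≤ a_J` if `a_j ≥ 0` and `a_j² ≤ a_{j+1}` for `j < J`.
[folklore] -/
theorem pow_two_pow_le_of_sq_le {a : ℕ → ℝ} (h0 : ∀ j, 0 ≤ a j) :
    ∀ J : ℕ, (∀ j, j < J → a j ^ 2 ≤ a (j + 1)) → a 0 ^ (2 ^ J) ≤ a J := by
  intro J
  induction J with
  | zero => intro _; simp
  | succ J ih =>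
      intro h
      have h1 : a 0 ^ (2 ^ J) ≤ a J := ih fun j hj => h j (Nat.lt_succ_of_lt hj)
      calc a 0 ^ (2 ^ (J + 1)) = (a 0 ^ (2 ^ J)) ^ 2 := by rw [pow_succ, pow_mul]
        _ ≤ a J ^ 2 := pow_le_pow_left₀ (pow_nonneg (h0 0) _) h1 2
        _ ≤ a (J + 1) := h J (Nat.lt_succ_self J)

end Abstract

/-! ## One-dimensional bookkeeping on the odd cycle `ℤ/L` -/

section OneDim

variable {L : ℕ} [NeZero L]

/-- **Run doubling on `ℤ/L`** read through an injective coordinate `σ` (`σ = id` or `σ = −`):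
for the run `J_q = {c | (σc).val < q}` and a map `t` with `σ(t c) = a − σ c`, `a.val = 2q − 1`,
`1 ≤ q`: `J_q ∪ t(J_q) = J_{2q}`, the two pieces are disjoint, and `#J_{2q} = 2 #J_q`. [folklore] -/
theorem run_double (σ t : ZMod L → ZMod L) (hσ : Function.Injective σ) (a : ZMod L) {q : ℕ}
    (hq : 1 ≤ q) (ha : a.val = 2 * q - 1) (ht : ∀ c, σ (t c) = a - σ c) :
    (Finset.univ.filter fun c : ZMod L => (σ c).val < q) ∪
        (Finset.univ.filter fun c : ZMod L => (σ c).val < q).image t =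
      (Finset.univ.filter fun c : ZMod L => (σ c).val < 2 * q) ∧
    Disjoint (Finset.univ.filter fun c : ZMod L => (σ c).val < q)
      ((Finset.univ.filter fun c : ZMod L => (σ c).val < q).image t) ∧
    (Finset.univ.filter fun c : ZMod L => (σ c).val < 2 * q).card =
      2 * (Finset.univ.filter fun c : ZMod L => (σ c).val < q).card := by
  have hval : ∀ c : ZMod L, (σ c).val < 2 * q → (σ (t c)).val = 2 * q - 1 - (σ c).val := by
    intro c hc
    rw [ht, ZMod.val_sub (by rw [ha]; omega), ha]
  have htt : ∀ c : ZMod L, t (t c) = c := fun c => hσ (by rw [ht, ht]; ring)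
  have htinj : Function.Injective t := fun c c' h => by simpa [htt] using congrArg t h
  have hunion : (Finset.univ.filter fun c : ZMod L => (σ c).val < q) ∪
      (Finset.univ.filter fun c : ZMod L => (σ c).val < q).image t =
      (Finset.univ.filter fun c : ZMod L => (σ c).val < 2 * q) := by
    ext c
    simp only [Finset.mem_union, Finset.mem_filter, Finset.mem_univ, true_and, Finset.mem_image]
    constructor
    · rintro (h | ⟨c₀, h₀, rfl⟩)
      · omega
      · rw [hval c₀ (by omega)]; omega
    · intro h
      by_cases hc : (σ c).val < q
      · exact Or.inl hc
      · refine Or.inr ⟨t c, ?_, htt c⟩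
        rw [hval c h]; omega
  have hdisj : Disjoint (Finset.univ.filter fun c : ZMod L => (σ c).val < q)
      ((Finset.univ.filter fun c : ZMod L => (σ c).val < q).image t) := by
    rw [Finset.disjoint_left]
    intro c hc hc'
    simp only [Finset.mem_filter, Finset.mem_univ, true_and, Finset.mem_image] at hc hc'
    obtain ⟨c₀, h₀, rfl⟩ := hc'
    rw [hval c₀ (by omega)] at hc
    omega
  refine ⟨hunion, hdisj, ?_⟩
  rw [← hunion, Finset.card_union_of_disjoint hdisj, Finset.card_image_of_injective _ htinj]
  ring

/-- The run of length one is `{0}` (for `σ` with `σ c = 0 ↔ c = 0`). [folklore] -/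
theorem run_one (σ : ZMod L → ZMod L) (hσ0 : ∀ c, σ c = 0 ↔ c = 0) :
    (Finset.univ.filter fun c : ZMod L => (σ c).val < 1) = {0} := by
  ext c
  simp only [Finset.mem_filter, Finset.mem_univ, true_and, Finset.mem_singleton, Nat.lt_one_iff,
    ZMod.val_eq_zero, hσ0]

omit [NeZero L] in
/-- **In-plane admissibility**: on the odd torus `L = 2m+1`, for `q ≤ m` and `k − 1 = q − m − 1`,
every `c` with `c.val < q` has `1 ≤ (c − (k−1)).val ≤ m` (the plaquette columns `m−q+1, …, m` next
to the fixed site hyperplane, in pulled-back time). [folklore] -/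
theorem adm_inplane {m q : ℕ} (hL : L = 2 * m + 1) (hqm : q ≤ m) {c : ZMod L} (hc : c.val < q) :
    1 ≤ (c - (((q : ℕ) : ZMod L) - ((m : ℕ) : ZMod L) - 1)).val ∧
      (c - (((q : ℕ) : ZMod L) - ((m : ℕ) : ZMod L) - 1)).val ≤ L / 2 := by
  have hm : L / 2 = m := by omega
  have hcast : c - (((q : ℕ) : ZMod L) - ((m : ℕ) : ZMod L) - 1) = c + ((m + 1 - q : ℕ) : ZMod L) := by
    rw [Nat.cast_sub (by omega)]; push_cast; ring
  have hv : ((m + 1 - q : ℕ) : ZMod L).val = m + 1 - q := ZMod.val_cast_of_lt (by omega)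
  rw [hcast, ZMod.val_add_of_lt (by rw [hv]; omega), hv, hm]
  omega

/-- **Transverse admissibility**: for `q ≤ m` (`L = 2m+1`) and `k − 1 = −q`, every `c` with
`(−c).val < q` has `1 ≤ (c − (k−1)).val ≤ m` (the slices `1, …, q` next to the link hyperplane,
in pulled-back time). [folklore] -/
theorem adm_transverse {m q : ℕ} (hL : L = 2 * m + 1) (hqm : q ≤ m) {c : ZMod L}
    (hc : (-c).val < q) :
    1 ≤ (c - (1 - ((q : ℕ) : ZMod L) - 1)).val ∧ (c - (1 - ((q : ℕ) : ZMod L) - 1)).val ≤ L / 2 := by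
  have hm : L / 2 = m := by omega
  have hv : ((q : ℕ) : ZMod L).val = q := ZMod.val_cast_of_lt (by omega)
  have hcast : c - (1 - ((q : ℕ) : ZMod L) - 1) = ((q : ℕ) : ZMod L) - (-c) := by ring
  rw [hcast, ZMod.val_sub (by rw [hv]; omega), hv, hm]
  omega

end OneDim

/-! ## Boxes: products of one-dimensional runs -/

section Boxes

variable {L : ℕ}

/-- The image of a box under a one-coordinate map is the box with that factor mapped. [folklore] -/
theorem image_update_piFinset (I : Fin 4 → Finset (ZMod L)) (i : Fin 4) (t : ZMod L → ZMod L) :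
    (Fintype.piFinset I).image (fun x => Function.update x i (t (x i))) =
      Fintype.piFinset (Function.update I i ((I i).image t)) := by
  ext y
  simp only [Finset.mem_image, Fintype.mem_piFinset]
  constructor
  · rintro ⟨x, hx, rfl⟩ a
    by_cases ha : a = i
    · subst ha; simp only [Function.update_self]; exact Finset.mem_image_of_mem _ (hx a)
    · simp only [Function.update_of_ne ha]; exact hx a
  · intro hy
    have hyi := hy i
    simp only [Function.update_self, Finset.mem_image] at hyi
    obtain ⟨c, hc, hct⟩ := hyi
    refine ⟨Function.update y i c, fun a => ?_, ?_⟩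
    · by_cases ha : a = i
      · subst ha; simpa using hc
      · have := hy a
        simp only [Function.update_of_ne ha] at this ⊢
        exact this
    · simp only [Function.update_self, Function.update_idem, hct, Function.update_eq_self]

/-- Union of two boxes differing in one factor. [folklore] -/
theorem piFinset_update_union (I : Fin 4 → Finset (ZMod L)) (i : Fin 4) (A B : Finset (ZMod L)) :
    Fintype.piFinset (Function.update I i A) ∪ Fintype.piFinset (Function.update I i B) =
      Fintype.piFinset (Function.update I i (A ∪ B)) := by
  ext y
  simp only [Finset.mem_union, Fintype.mem_piFinset]
  constructor
  · rintro (h | h) a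
    · by_cases ha : a = i
      · subst ha; have := h a; simp only [Function.update_self] at this ⊢
        exact Finset.mem_union_left _ this
      · have := h a; simp only [Function.update_of_ne ha] at this ⊢; exact this
    · by_cases ha : a = i
      · subst ha; have := h a; simp only [Function.update_self] at this ⊢
        exact Finset.mem_union_right _ this
      · have := h a; simp only [Function.update_of_ne ha] at this ⊢; exact this
  · intro h
    have hi := h i
    simp only [Function.update_self, Finset.mem_union] at hi
    rcases hi with hi | hi
    · refine Or.inl fun a => ?_
      by_cases ha : a = i
      · subst ha; simpa using hi
      · have := h a; simp only [Function.update_of_ne ha] at this ⊢; exact this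
    · refine Or.inr fun a => ?_
      by_cases ha : a = i
      · subst ha; simpa using hi
      · have := h a; simp only [Function.update_of_ne ha] at this ⊢; exact this

end Boxes


/-! ## Lattice layer: transported odd reflection positivity and plaquette bookkeeping -/

section Lattice

variable {d L N : ℕ} [NeZero d] [NeZero L] {G : Type*} [Group G] [TopologicalSpace G]
  [IsTopologicalGroup G] [CompactSpace G] [MeasurableSpace G] [BorelSpace G]
  (ρ : G →* Matrix (Fin N) (Fin N) ℂ)

/-- **Transported odd-torus reflection positivity** (`L` odd, `L ≥ 3`, `β ≥ 0`, real uncentred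
form): for bounded measurable real `F` depending only on the links whose pull-back by
`Φ = τ_v ∘ π_*` is odd-positive or shared, `0 ≤ ∫ F(ΘU) F(U) dμ_β` with `Θ = Φ ∘ Θ₀ ∘ Φ⁻¹`
(cf. `FiniteSusceptibilityWeakCoupling.stub_oddTorusRP`, there with `L = 2S+1` syntactically).
[folklore] -/
theorem integral_oddTheta_mul_nonneg (hL : Odd L) (hL3 : 3 ≤ L) (hρ : Continuous ρ) {β : ℝ}
    (hβ : 0 ≤ β) (π : Equiv.Perm (Fin d)) (v : Site d L) (F : GaugeConfig d L G → ℝ)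
    (hF : Measurable F) (hFb : ∃ C : ℝ, ∀ U, |F U| ≤ C)
    (hFdep : DependsOn F {e : Edge d L |
      WilsonOddRP.IsOPosEdge ((sitePerm π.symm (e.1 - v), π.symm e.2) : Edge d L) ∨
        WilsonOddRP.IsOSharedEdge ((sitePerm π.symm (e.1 - v), π.symm e.2) : Edge d L)}) :
    0 ≤ ∫ U, F (torusConfigShift v (configPerm π (GaugeConfig.timeReflect (configPerm π.symm
      (torusConfigShift (-v) U))))) * F U ∂(wilsonMeasure (d := d) (L := L) ρ β) := by
  -- adapted from `PlaquetteProductRPCS.integral_siteTheta_mul_nonneg` (even torus, site mirror)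
  obtain ⟨C, hC⟩ := hFb
  have hdep : DependsOn (fun W : GaugeConfig d L G => F (torusConfigShift v (configPerm π W)))
      ((WilsonOddRP.oPosEdges ∪ WilsonOddRP.oSharedEdges : Finset (Edge d L)) :
        Set (Edge d L)) := by
    have h := dependsOn_comp_phi π v
      (Q := {e : Edge d L | WilsonOddRP.IsOPosEdge e ∨ WilsonOddRP.IsOSharedEdge e}) hFdep
    intro W W' hWW'
    refine h fun e he => hWW' e ?_
    rw [Finset.coe_union, Set.mem_union, Finset.mem_coe, Finset.mem_coe,
      WilsonOddRP.mem_oPosEdges, WilsonOddRP.mem_oSharedEdges]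
    exact he
  have h0 : 0 ≤ ∫ W, F (torusConfigShift v (configPerm π (GaugeConfig.timeReflect W))) *
      F (torusConfigShift v (configPerm π W)) ∂(wilsonMeasure (d := d) (L := L) ρ β) :=
    AxisCovNonneg.integral_timeReflect_mul_nonneg_odd ρ hL hL3 hρ hβ _
      (hF.comp ((torusConfigShift v).measurable.comp (configPerm π).measurable))
      ⟨C, fun W => hC _⟩ hdep
  rw [← map_configPerm_trans_torusConfigShift ρ hρ β π v, integral_map_equiv]
  refine h0.trans_eq (integral_congr_ae (Filter.Eventually.of_forall fun W => ?_))
  simp only [MeasurableEquiv.trans_apply, RPCauchySchwarz.torusConfigShift_neg_shift,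
    RPCauchySchwarz.configPerm_symm_configPerm]

omit [NeZero L] [MeasurableSpace G] [BorelSpace G] in
/-- The link reflection acts on `Re tr` of a TEMPORAL plaquette holonomy (plane `(0, b)` or
`(b, 0)`) by `y ↦ θ(y + e₀)` on the base point (tree `WilsonRP.plaqRe_timeReflect`). [folklore] -/
theorem re_tr_plaquetteHolonomy_timeReflect_temporal (hρ : Continuous ρ) (U : GaugeConfig d L G)
    (y : Site d L) {a b : Fin d} (hab : (a = 0 ∧ b ≠ 0) ∨ (b = 0 ∧ a ≠ 0)) :
    (ρ (plaquetteHolonomy U.timeReflect y a b)).trace.re =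
      (ρ (plaquetteHolonomy U (y.shift 0).timeReflect a b)).trace.re := by
  -- adapted from `PlaquetteProductRPCS.re_tr_plaquetteHolonomy_negReflect_temporal`
  have key : ∀ {c : Fin d}, c ≠ 0 → (ρ (plaquetteHolonomy U.timeReflect y 0 c)).trace.re =
      (ρ (plaquetteHolonomy U (y.shift 0).timeReflect 0 c)).trace.re := by
    intro c hc
    have hlt : (0 : Fin d) < c := by
      rcases lt_or_eq_of_le (Fin.zero_le c) with h | h
      · exact h
      · exact absurd h.symm hc
    have h := WilsonRP.plaqRe_timeReflect ρ hρ U ((y, ⟨((0 : Fin d), c), hlt⟩) : Plaquette d L)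
    simpa [WilsonRP.plaqRe, WilsonRP.plaqReflect] using h
  rcases hab with ⟨rfl, hb⟩ | ⟨rfl, ha⟩
  · exact key hb
  · rw [re_tr_plaquetteHolonomy_swap ρ hρ, key ha, ← re_tr_plaquetteHolonomy_swap ρ hρ]

omit [NeZero L] [BorelSpace G] in
/-- **In-plane directions**: for `i ∈ {0, 1}` the LINK reflection transported by `(0 i)` and
`(k−1)eᵢ` maps `Re tr` of the `01`-plaquette holonomy at `x` to the one at `x[i ↦ 2k − 2 − xᵢ]`
(`= cellReflect i k (x + eᵢ)`; the reflected plaquette has reversed orientation). [folklore] -/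
theorem re_tr_plaq01_oddTheta_inplane (hρ : Continuous ρ) {i : Fin 4} (h01 : i = 0 ∨ i = 1)
    (k : ZMod L) (U : GaugeConfig 4 L G) (x : Site 4 L) :
    (ρ (plaquetteHolonomy (torusConfigShift (Pi.single i (k - 1)) (configPerm (Equiv.swap 0 i)
      (GaugeConfig.timeReflect (configPerm (Equiv.swap 0 i).symm
        (torusConfigShift (-Pi.single i (k - 1)) U))))) x 0 1)).trace.re =
      (ρ (plaquetteHolonomy U (Function.update x i (2 * k - 2 - x i)) 0 1)).trace.re := by
  -- adapted from `PlaquetteProductRPCS.re_tr_plaquetteHolonomy_siteTheta`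
  have hab : (i = 0 ∧ Equiv.swap (0 : Fin 4) i 1 ≠ 0) ∨
      (Equiv.swap (0 : Fin 4) i 1 = 0 ∧ i ≠ 0) := by
    rcases h01 with rfl | rfl
    · left; decide
    · right; decide
  simp only [plaquetteHolonomy_torusConfigShift, plaquetteHolonomy_configPerm, Equiv.symm_swap,
    Equiv.swap_apply_left]
  rw [re_tr_plaquetteHolonomy_timeReflect_temporal ρ hρ _ _ hab]
  simp only [plaquetteHolonomy_configPerm, Equiv.symm_swap, Equiv.swap_apply_right,
    Equiv.swap_apply_self, plaquetteHolonomy_torusConfigShift]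
  have hz : sitePerm (Equiv.swap (0 : Fin 4) i)
      (((sitePerm (Equiv.swap (0 : Fin 4) i)) (x - Pi.single i (k - 1))).shift 0).timeReflect -
        -Pi.single i (k - 1) = Function.update x i (2 * k - 2 - x i) := by
    funext j
    by_cases hj : j = i
    · subst hj
      simp only [sitePerm_apply, Equiv.symm_swap, Equiv.swap_apply_right, Pi.sub_apply,
        Pi.neg_apply, WilsonRP.timeReflect_apply_zero, WilsonRP.shift_apply_self,
        Equiv.swap_apply_left, Pi.single_eq_same, Function.update_self]
      ring
    · have hm : Equiv.swap (0 : Fin 4) i j ≠ 0 := by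
        rw [Ne, swap_zero_apply_eq_zero_iff]; exact hj
      rw [Pi.sub_apply, Pi.neg_apply, sitePerm_apply, Equiv.symm_swap,
        WilsonRP.timeReflect_apply_of_ne _ hm, WilsonRP.shift_apply_of_ne _ hm, sitePerm_apply,
        Equiv.symm_swap, Equiv.swap_apply_self]
      simp [hj]
  rw [hz]

omit [NeZero L] [TopologicalSpace G] [IsTopologicalGroup G] [CompactSpace G] [BorelSpace G] in
/-- **Transverse directions**: for `i ∉ {0, 1}` the transported link reflection maps the
`01`-plaquette holonomy at `x` to the one at `x[i ↦ 2k − 1 − xᵢ]` (tree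
`plaquetteHolonomy_linkTheta`, restated with `Function.update`). [folklore] -/
theorem plaq01_oddTheta_transverse {i : Fin 4} (hi0 : i ≠ 0) (hi1 : i ≠ 1) (k : ZMod L)
    (U : GaugeConfig 4 L G) (x : Site 4 L) :
    plaquetteHolonomy (torusConfigShift (Pi.single i (k - 1)) (configPerm (Equiv.swap 0 i)
      (GaugeConfig.timeReflect (configPerm (Equiv.swap 0 i).symm
        (torusConfigShift (-Pi.single i (k - 1)) U))))) x 0 1 =
      plaquetteHolonomy U (Function.update x i (2 * k - 1 - x i)) 0 1 := by
  rw [plaquetteHolonomy_linkTheta hi0 hi1, cellReflect_apply]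

end Lattice

end Summit.QuantumFields.YangMills.Theorems.FemtoCurvatureTwoPointC.OddChessboard

namespace Summit.QuantumFields.YangMills.Theorems.FemtoCurvatureTwoPointC

/-- **Registered sub-goal `stub_oddTransportedRP`** (`--supports stmt-QuantumFields-16204`, line
`conditional-covariance-floor`, stub V′ odd tori): reflection positivity of Wilson's lattice gauge
measure on an ODD torus `L ≥ 3` in EVERY axis direction `π 0` and EVERY hyperplane `v`, real
uncentred form, `β ≥ 0` (closed form of `OddChessboard.integral_oddTheta_mul_nonneg`, fully
qualified; the general-`L` form of `FiniteSusceptibilityWeakCoupling.stub_oddTorusRP`). [folklore] -/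
theorem stub_oddTransportedRP : ∀ (d L N : ℕ) [NeZero d] [NeZero L] (G : Type) [Group G] [TopologicalSpace G] [IsTopologicalGroup G] [CompactSpace G] [MeasurableSpace G] [BorelSpace G] (ρ : G →* Matrix (Fin N) (Fin N) ℂ), Odd L → 3 ≤ L → Continuous ρ → ∀ (β : ℝ), 0 ≤ β → ∀ (π : Equiv.Perm (Fin d)) (v : Literature.MathematicalPhysics.QuantumFieldTheory.Site d L) (F : Literature.MathematicalPhysics.QuantumFieldTheory.GaugeConfig d L G → ℝ), Measurable F → (∃ C : ℝ, ∀ U, |F U| ≤ C) → DependsOn F {e : Literature.MathematicalPhysics.QuantumFieldTheory.Edge d L | Literature.MathematicalPhysics.QuantumFieldTheory.WilsonOddRP.IsOPosEdge (Literature.MathematicalPhysics.QuantumFieldTheory.sitePerm π.symm (e.1 - v), π.symm e.2) ∨ Literature.MathematicalPhysics.QuantumFieldTheory.WilsonOddRP.IsOSharedEdge (Literature.MathematicalPhysics.QuantumFieldTheory.sitePerm π.symm (e.1 - v), π.symm e.2)} → 0 ≤ ∫ U, F (Literature.MathematicalPhysics.QuantumFieldTheory.torusConfigShift v (Literature.MathematicalPhysics.QuantumFieldTheory.configPerm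 π (Literature.MathematicalPhysics.QuantumFieldTheory.GaugeConfig.timeReflect (Literature.MathematicalPhysics.QuantumFieldTheory.configPerm π.symm (Literature.MathematicalPhysics.QuantumFieldTheory.torusConfigShift (-v) U))))) * F U ∂(Literature.MathematicalPhysics.QuantumFieldTheory.wilsonMeasure ρ β : MeasureTheory.Measure (Literature.MathematicalPhysics.QuantumFieldTheory.GaugeConfig d L G)) := by
  intro d L N _ _ G _ _ _ _ _ _ ρ hL hL3 hρ β hβ π v F hF hFb hFdep
  exact OddChessboard.integral_oddTheta_mul_nonneg ρ hL hL3 hρ hβ π v F hF hFb hFdep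

end Summit.QuantumFields.YangMills.Theorems.FemtoCurvatureTwoPointC

end
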